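import Summits.BirchSwinnertonDyer.Rank1Residual.Additive.QuadraticBranchEvenControlLowerNoKO
import Summits.BirchSwinnertonDyer.Rank1Residual.Additive.QuadraticBranchEvenValueIdentity
import Summits.BirchSwinnertonDyer.Rank1Residual.Additive.X4RankZeroKatoBound
import Summits.BirchSwinnertonDyer.Rank1Residual.Additive.X4RankZeroKatoBoundTamagawaExact
import Literature.NumberTheory.EllipticCurves.Wuthrich2014.ShaBoundProofs
import HarnessLib

/-!
# From the even control to Miller's currency: the LOWER half `ord_p #Ш(W)_an ≤ ord_p #Ш(W)` in analytic
# rank `0` from the two readings (R1⁺) + (R2⁺) and (C1_η) — (L0⁺) (Kobayashi (9.33)) and the VALUE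
# identity `v_p(L_p⁺(V, η, 0)) = v_p(L(W,1)/Ω_W)` being THEOREMS — and `BSD(W, p)` with Kato's upper
# half (cell `bsd-potss`, seat `bsd-potss-ctrl` g2; file 6 of the T-e2-r0 series)

HONEST FRAMING (cell `bsd-potss`, run/shared/lean/pub/bsd-potss/; FULL-BSD rank ≤ 1 programme,
tranche 1b): THEOREMS ONLY — no definition, no named Literature fact, no Summits-side fact `def … :
Prop`, no `sorry`, axioms standard. CONDITIONAL on: the two typed readings (R1⁺), (R2⁺) of file 2
(DISPLAYED; (L0⁺) = Kobayashi (9.33) is DISCHARGED in `QuadraticBranchEvenLocalControl`, the value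
identity (3.6) + Birch + Pal in `QuadraticBranchEvenValueIdentity`); (C1_η)
`QuadraticBranchPlusMainConjectureAt V p` (a hypothesis INSIDE, OPEN for non-CM `V`); the named facts
GZK (`rank_eq_analyticRank_of_analyticRank_le_one`), modularity (`hasEntireLFunction_rat`) and, for
`BSD(W,p)`, Kato's Thm. 14.5(3) binder `hKato` with its (12.5.2) / Tamagawa-free / Manin side
conditions exactly as in additive-p4's `X4RankZero.bsdp_of_missingLowerBoundAt_of_kato`. Nothing is
booked; no label / mark / count moves; Gss2 / O5a stay OPEN.

## What

* §1 `missingLowerBoundAt_rankZero_of_selmer_le` — pure bookkeeping (Miller's currency in rank `0`):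
  if `L(W,1) = q·Ω_W ≠ 0` (`q ∈ ℚ`) and `v_p(q) ≤ ord_p #Sel_{p^∞}(W/ℚ) + ord_p(Tam(W)/#W(ℚ)_tors²)`,
  then `Typed.MissingLowerBoundAt W p` (GZK: `rank = 0`, `Ш` finite; `#Sel_{p^∞} = #Ш[p^∞]` in rank `0`;
  `#Ш_an = q·#tors²/Tam`, tree `Wuthrich2014.shaAn_eq_of_L_one_div_eq`).
* §2 `exists_rat_entireLFunction_one_div_of_twist` (`L(W,1)/Ω_W ∈ ℚ` for the twist, by Birch) and
  **`missingLowerBoundAt_rankZero_of_evenReadings`** — (R1⁺) + (R2⁺) + (C1_η)(V) ⟹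
  `Typed.MissingLowerBoundAt W p` for the `p*`-twist `W` (`p ≥ 5`) of a good `a_p = 0` curve with
  `L(W, 1) ≠ 0` — file 5's right inequality read in Miller's currency.
* §4 **`missingLowerBoundAt_rankZero_of_evenReading`**, **`bsdp_rankZero_of_evenReading_of_kato`** — the
  same from (R1⁺) + (C1_η) ALONE (no Kitajima–Otsuki reading: `QuadraticBranchEvenControlLowerNoKO`), every ODD `p`;
  `bsdp_rankZero_of_evenReading_of_katoTam` — with Kato's Tamagawa-exact upper half (no `p ∤ Tam`, no Manin).
* §3 **`bsdp_rankZero_of_evenReadings_of_kato`** — with Kato's upper half on the (12.5.2),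
  Tamagawa-free, Manin-free rows (additive-p4 `X4RankZero.bsdp_of_missingLowerBoundAt_of_kato`):
  `BSDp W p`. (The EXACT form of T-e2-r0 — Cassels–Poitou–Tate in rank `0`, sequel — removes Kato and
  its side conditions from this corollary.)

References: [Kobayashi2003] (3.6) (p. 7), §4 (p. 8), Thm. 9.3 (p. 26); [GreenbergLNM1716] §4 Thm. 4.1;
[Miller2011LMS] §1, Def. 1.1; [Kato2004Asterisque] Thm. 14.5 (3); [Wuthrich2014] Prop. 21 (shape of §1);
[MazurTateTeitelbaum1986Invent] §I.8 (8.6).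
-/

noncomputable section

open scoped Classical MatrixGroups ModularForm

open CongruenceSubgroup Field Function NumberField IsDedekindDomain WeierstrassCurve
open Literature.NumberTheory.EllipticCurves
open Literature.NumberTheory.EllipticCurves.ModularForms
open Literature.NumberTheory.EllipticCurves.Kobayashi2003
open Literature.NumberTheory.EllipticCurves.Rank1Residual
open Literature.NumberTheory.EllipticCurves.Rank1Residual.Typed
open Literature.NumberTheory.GaloisRepresentations
open Literature.NumberTheory.EllipticCurves.IwasawaAlgebra
open Literature.NumberTheory.EllipticCurves.IwasawaDual ZpExtension

namespace Summit.BirchSwinnertonDyer.Rank1Residual.Additive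

namespace EvenControlZero

variable (W : WeierstrassCurve ℚ) [W.IsElliptic] [W.IsGloballyMinimal] (p : ℕ) [hp : Fact p.Prime]

/-! ## §1 Bookkeeping: a Selmer-side inequality in rank `0` is the lower half in Miller's currency -/

/-- **Rank-`0` bookkeeping.** If `L(W,1) ≠ 0`, `L(W,1)/Ω_W = q ∈ ℚ`, and
`v_p(q) ≤ ord_p #Sel_{p^∞}(W/ℚ) + ord_p(Tam(W)/#W(ℚ)_tors²)`, then `ord_p #Ш(W)_an ≤ ord_p #Ш(W)`
(`Typed.MissingLowerBoundAt W p`): GZK gives `rank W(ℚ) = 0` and `Ш(W)` finite, so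
`#Sel_{p^∞}(W/ℚ) = #Ш(W)[p^∞]` (`natCard_selmerGroupPInfty_eq_natCard_primaryComponent_sha`),
`ord_p #Ш[p^∞] = ord_p #Ш`, and `#Ш_an = q·#W(ℚ)²/Tam(W)` (`Wuthrich2014.shaAn_eq_of_L_one_div_eq`).
[cite: Miller2011LMS, §1 and Def. 1.1] [cite: GreenbergLNM1716, §1 p. 54 and §4 p. 103] -/
theorem missingLowerBoundAt_rankZero_of_selmer_le
    (hGZK : rank_eq_analyticRank_of_analyticRank_le_one) (hL : W.entireLFunction 1 ≠ 0) {q : ℚ}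
    (hq : W.entireLFunction 1 / (W.realPeriodRat : ℂ) = (q : ℂ))
    (hle : padicValRat p q ≤ (padicValNat p (Nat.card ↥(W.selmerGroupPInfty p)) : ℤ) +
      padicValRat p ((W.tamagawaProduct : ℚ) / (W.torsionOrder : ℚ) ^ 2)) :
    MissingLowerBoundAt W p := by
  obtain ⟨hmw0, hE, hfin, hshaAn⟩ := Wuthrich2014.shaAn_eq_of_L_one_div_eq hGZK W hL hq
  haveI := hE
  haveI := hfin
  have hΩ : (W.realPeriodRat : ℂ) ≠ 0 := by exact_mod_cast W.realPeriodRat_pos_holds.ne'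
  have hq0 : q ≠ 0 := by
    rintro rfl
    apply hL
    have h := hq
    rw [Rat.cast_zero, div_eq_zero_iff] at h
    exact h.resolve_right hΩ
  have hT0 : W.torsionOrder ≠ 0 := W.torsionOrder_pos_holds.ne'
  have hTq : (W.torsionOrder : ℚ) ≠ 0 := by exact_mod_cast hT0
  have hPq : (W.tamagawaProduct : ℚ) ≠ 0 := by exact_mod_cast W.tamagawaProduct_pos_holds.ne'
  have hcardT : (Nat.card W.toAffine.Point : ℚ) = (W.torsionOrder : ℚ) := by
    rw [W.torsionOrder_eq_natCard_of_finite]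
  refine ⟨q * (Nat.card W.toAffine.Point : ℚ) ^ 2 / (W.tamagawaProduct : ℚ), hshaAn, ?_⟩
  -- `ord_p` of the witness
  rw [hcardT, padicValRat.div (mul_ne_zero hq0 (pow_ne_zero 2 hTq)) hPq,
    padicValRat.mul hq0 (pow_ne_zero 2 hTq), padicValRat.pow]
  rw [padicValRat.div hPq (pow_ne_zero 2 hTq), padicValRat.pow] at hle
  -- `#Sel_{p^∞} = #Ш[p^∞]`, `ord_p #Ш[p^∞] = ord_p #Ш`
  have hSel := W.natCard_selmerGroupPInfty_eq_natCard_primaryComponent_sha p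
  have hSha : padicValNat p (Nat.card (AddCommGroup.primaryComponent W.sha p)) =
      padicValNat p W.shaOrder := by
    rw [WeierstrassCurve.shaOrder, padicValNat_card_addPrimaryComponent]
  rw [hSel, hSha] at hle
  linarith

/-! ## §2 `L(W,1)/Ω_W` is rational for the `p*`-twist, and the lower half from the even readings -/

/-- **`L(W,1)/Ω_W ∈ ℚ` for the `p*`-twist `W` of a good-at-`p` curve `V`** (`p` odd): Birch's formula
for the twist (tree `entireLFunction_one_eq_of_twist_pos` / `_neg_signed`: `L(W,1) = ϖ S^± Ω_W (/c_∞)`),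
the twist read backwards (`exists_variableChange_quadraticTwist_symm`) and `W` additive at `p`
(`addv_of_twist_pStar`). Modularity (`hmod`) displayed. [cite: MazurTateTeitelbaum1986Invent, §I.8 (8.6)]
[cite: SilvermanAEC2009, VII.5 Prop. 5.1] -/
theorem exists_rat_entireLFunction_one_div_of_twist (hmod : hasEntireLFunction_rat) (hp2 : p ≠ 2)
    (V : WeierstrassCurve ℚ) [V.IsElliptic] [V.IsGloballyMinimal] (C : VariableChange ℚ)
    {N : ℕ} [NeZero N] {f : CuspForm (Gamma0 N) 2}
    (hCV : C • W.quadraticTwist ((-1) ^ (p / 2) * p) = V) (hgood : V.HasGoodReductionAtPrime p)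
    (hf : IsNewformOf V f) {ϖ : ℚ}
    (hϖ : if Even (p / 2) then (ϖ : ℝ) * V.realPeriodRat = plusPeriod f
      else (ϖ : ℝ) * V.imaginaryPeriodRat = minusPeriod f) :
    ∃ q : ℚ, W.entireLFunction 1 / (W.realPeriodRat : ℂ) = (q : ℂ) := by
  have hP : p.Prime := hp.out
  have hd : ((-1 : ℚ) ^ (p / 2) * p) ≠ 0 :=
    mul_ne_zero (pow_ne_zero _ (neg_ne_zero.mpr one_ne_zero)) (Nat.cast_ne_zero.mpr hP.ne_zero)
  haveI := W.isElliptic_quadraticTwist hd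
  obtain ⟨C', hC'⟩ := exists_variableChange_quadraticTwist_symm (W := V) W hd ⟨C, hCV⟩
  have hjW : 0 ≤ padicValRat p W.j := by
    have htw : (W.quadraticTwist ((-1 : ℚ) ^ (p / 2) * p)).HasGoodReductionAtPrime p := by
      rw [← hCV] at hgood
      exact (BSZLemma17.hasGoodReductionAtPrime_smul_iff _ C p).mp hgood
    exact padicValRat_j_nonneg_of_typeG W p (typeG_of_hasGoodReductionAtPrime_quadraticTwist W p hp2 htw)
  have hjV : 0 ≤ padicValRat p V.j := by
    have e : V.j = W.j := by subst hCV; rw [variableChange_j, j_quadraticTwist W hd]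
    exact e ▸ hjW
  have hΔV : padicValInt p V.minimalDiscriminantInt < 6 := by
    rw [padicValInt.eq_zero_of_not_dvd (not_dvd_minimalDiscriminantInt_of_hasGoodReductionAtPrime' V p hgood)]
    norm_num
  obtain ⟨hadd, -, -⟩ := addv_of_twist_pStar p hp2 V W hjV hΔV C' hC'
  have hΩ : (W.realPeriodRat : ℂ) ≠ 0 := by exact_mod_cast W.realPeriodRat_pos_holds.ne'
  by_cases hev : Even (p / 2)
  · have hp4 : p % 4 = 1 := (even_half_iff_mod_four p hp2).mp hev
    rw [if_pos hev] at hϖ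
    have hC'' : C' • V.quadraticTwist (p : ℚ) = W := by rw [← hC', hev.neg_one_pow, one_mul]
    refine ⟨ϖ * legendrePlusSymbolSum f p, ?_⟩
    rw [entireLFunction_one_eq_of_twist_pos p hmod hp4 V W C' hC'' (Or.inl hgood) hadd hf ϖ hϖ,
      mul_div_assoc, div_self hΩ, mul_one]
  · have hp4 : p % 4 = 3 := by
      have hodd : p % 2 = 1 := Nat.odd_iff.mp (hP.odd_of_ne_two hp2)
      have h := (even_half_iff_mod_four p hp2).not.mp hev
      omega
    rw [if_neg hev] at hϖ
    have hC'' : C' • V.quadraticTwist (-(p : ℚ)) = W := by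
      rw [← hC', (Nat.not_even_iff_odd.mp hev).neg_one_pow, neg_one_mul]
    refine ⟨ϖ * legendreMinusSymbolSum f p / ((W.baseChange ℝ).numRealComponents : ℚ), ?_⟩
    rw [entireLFunction_one_eq_of_twist_neg_signed p hmod hp4 V W C' hC'' (Or.inl hgood) hadd hf ϖ hϖ,
      mul_div_assoc, div_self hΩ, mul_one]

/-- **The LOWER half `ord_p #Ш(W)_an ≤ ord_p #Ш(W)` in analytic rank `0` from (R1⁺) + (R2⁺) + (C1_η).**
For `W` globally minimal with `L(W,1) ≠ 0`, `p ≥ 5`, the good `a_p = 0` twin `V`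
(`C • W.quadraticTwist ((−1)^{p/2} p) = V`) with (C1_η), newform `f`, period ratio `ϖ` and ANY `L`
with `IsQuadraticBranchPlusLFunction f p ϖ L`: **`Typed.MissingLowerBoundAt W p`**. (L0⁺) is the
theorem `evenBranchPlusLocalControlZeroAt_holds` (Kobayashi (9.33)); the value identity
`v_p(L(0)) = v_p(L(W,1)/Ω_W)` and `L(0) ≠ 0` are the theorem
`valuation_constantCoeff_eq_padicValRat_of_twist` ((3.6) + Birch + Pal). CONDITIONAL on the two
readings, (C1_η), GZK and modularity (displayed); nothing booked.
[cite: Kobayashi2003, (3.6) (p. 7), §4 (p. 8), Thm. 9.3 with (9.33) (pp. 26–27)]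
[cite: GreenbergLNM1716, §4 Thm. 4.1] [cite: Miller2011LMS, Def. 1.1]
[cite: KitajimaOtsuki2018, Main Thm. 1.3 (arXiv:1607.03612 p. 3)] -/
theorem missingLowerBoundAt_rankZero_of_evenReadings
    (hGZK : rank_eq_analyticRank_of_analyticRank_le_one) (hmod : hasEntireLFunction_rat)
    (hR1 : EvenBranchPlusCharIdealOfPlusMCAt W p) (hR2 : EvenBranchPlusNoFiniteSubmoduleAt W p)
    (V : WeierstrassCurve ℚ) [V.IsElliptic] [V.IsGloballyMinimal] (C : VariableChange ℚ)
    {N : ℕ} [NeZero N] {f : CuspForm (Gamma0 N) 2}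
    (hp5 : 5 ≤ p) (hCV : C • W.quadraticTwist ((-1) ^ (p / 2) * p) = V)
    (hgood : V.HasGoodReductionAtPrime p) (hap : V.frobeniusTrace p = 0)
    (h1 : QuadraticBranchPlusMainConjectureAt V p) (hf : IsNewformOf V f) {ϖ : ℚ}
    (hϖ : if Even (p / 2) then (ϖ : ℝ) * V.realPeriodRat = plusPeriod f
      else (ϖ : ℝ) * V.imaginaryPeriodRat = minusPeriod f)
    {L : IwasawaAlgebra p} (hL : IsQuadraticBranchPlusLFunction f p ϖ L)
    (hLW : W.entireLFunction 1 ≠ 0) :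
    MissingLowerBoundAt W p := by
  have hp2 : p ≠ 2 := by omega
  obtain ⟨q, hq⟩ := exists_rat_entireLFunction_one_div_of_twist W p hmod hp2 V C hCV hgood hf hϖ
  obtain ⟨hval, h0⟩ := valuation_constantCoeff_eq_padicValRat_of_twist p hmod hp2 W V C hCV hgood hf hϖ hL hq
  obtain ⟨-, -, hle⟩ := finite_and_padicValNat_card_selmerGroupPInfty_le_and_le_of_readings' W p hR1 hR2
    V C hp5 hCV hgood hap h1 hf hϖ hL (h0 hLW)
  rw [hval] at hle
  exact missingLowerBoundAt_rankZero_of_selmer_le W p hGZK hLW hq hle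

/-! ## §3 `BSD(W, p)` with Kato's upper half -/

/-- **`BSD(W, p)` in analytic rank `0` on the (12.5.2), Tamagawa-free, Manin-free Gss2 rows from the
two even readings + (C1_η) + Kato's Thm. 14.5(3).** §2 gives the lower half; additive-p4's
`X4RankZero.bsdp_of_missingLowerBoundAt_of_kato` supplies the upper half from the named-fact binder
`hKato` under its side conditions (`ClassX4 W p`, `ρ_{W,p^n}` onto for all `n`, `p ∤ Tam(W)`, `p ∤ c_D`;
`ord_p j(W) ≥ 0` is automatic for the twist of a good curve). CONDITIONAL on all displayed inputs;
nothing booked; the EXACT T-e2-r0 (Cassels–Poitou–Tate in rank `0`, sequel) makes `hKato` and its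
side conditions unnecessary. [cite: Kato2004Asterisque, Thm. 14.5 (3) (p. 236), (12.5.2) (p. 222)]
[cite: Miller2011LMS, §1 and Def. 1.1] [cite: Kobayashi2003, §4 (p. 8), Thm. 9.3 (p. 26), (3.6) (p. 7)] -/
theorem bsdp_rankZero_of_evenReadings_of_kato
    (hKato : Kato2004.rankZero_padicValNat_sha_le_of_additive_potGood_of_imageContainsSL2)
    (hGZK : rank_eq_analyticRank_of_analyticRank_le_one) (hmod : hasEntireLFunction_rat)
    (hR1 : EvenBranchPlusCharIdealOfPlusMCAt W p) (hR2 : EvenBranchPlusNoFiniteSubmoduleAt W p)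
    (V : WeierstrassCurve ℚ) [V.IsElliptic] [V.IsGloballyMinimal] (C : VariableChange ℚ)
    {N : ℕ} [NeZero N] {f : CuspForm (Gamma0 N) 2}
    (hp5 : 5 ≤ p) (hCV : C • W.quadraticTwist ((-1) ^ (p / 2) * p) = V)
    (hgood : V.HasGoodReductionAtPrime p) (hap : V.frobeniusTrace p = 0)
    (h1 : QuadraticBranchPlusMainConjectureAt V p) (hf : IsNewformOf V f) {ϖ : ℚ}
    (hϖ : if Even (p / 2) then (ϖ : ℝ) * V.realPeriodRat = plusPeriod f
      else (ϖ : ℝ) * V.imaginaryPeriodRat = minusPeriod f)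
    {L : IwasawaAlgebra p} (hL : IsQuadraticBranchPlusLFunction f p ϖ L)
    (hr : W.analyticRank = 0) (hX : ClassX4 W p)
    (hsurj : ∀ n : ℕ, W.HasSurjectiveModNGaloisRep (p ^ n : ℕ)) (htam : ¬ p ∣ W.tamagawaProduct)
    {M : ℕ} [NeZero M] (D : ModularParametrizationData W M) (hc : ¬ (p : ℤ) ∣ D.maninConstant) :
    BSDp W p := by
  have hp2 : p ≠ 2 := by omega
  -- `L(W,1) ≠ 0`
  have hLW : W.entireLFunction 1 ≠ 0 := by
    rw [← W.leadingLCoeff_eq_of_analyticRank_eq_zero hr]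
    exact W.leadingLCoeff_ne_zero_holds (hmod W)
  -- `ord_p j(W) ≥ 0`: the twist of a good curve has Delbourgo's type (G)
  have htw : (W.quadraticTwist ((-1 : ℚ) ^ (p / 2) * p)).HasGoodReductionAtPrime p := by
    rw [← hCV] at hgood
    exact (BSZLemma17.hasGoodReductionAtPrime_smul_iff _ C p).mp hgood
  have hpot : 0 ≤ padicValRat p W.j :=
    padicValRat_j_nonneg_of_typeG W p (typeG_of_hasGoodReductionAtPrime_quadraticTwist W p hp2 htw)
  exact X4RankZero.bsdp_of_missingLowerBoundAt_of_kato W p hKato hGZK hmod hr hX hpot hsurj htam D hc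
    (missingLowerBoundAt_rankZero_of_evenReadings W p hGZK hmod hR1 hR2 V C hp5 hCV hgood hap h1 hf hϖ hL
      hLW)

/-! ## §4 The same WITHOUT the Kitajima–Otsuki reading: (R1⁺) + (C1_η) only -/

/-- **The LOWER half `ord_p #Ш(W)_an ≤ ord_p #Ш(W)` in analytic rank `0` from (R1⁺) + (C1_η) ALONE** (no
(R2⁺): the `hnf`-free inequality `finite_and_valuation_le_padicValNat_card_add_of_reading` of
`QuadraticBranchEvenControlLowerNoKO` replaces file 5), for every ODD `p` (the `a₃(V) = 0` share of
`p = 3` included). Same binders as §2 minus `hR2`, `5 ≤ p ↦ p ≠ 2`. CONDITIONAL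
on (R1⁺), (C1_η), GZK and modularity; nothing booked.
[cite: Kobayashi2003, (3.6) (p. 7), §4 (p. 8), Thm. 9.3 with (9.33) (pp. 26–27)]
[cite: GreenbergLNM1716, §4 Thm. 4.1 and Lemma 4.2 (p. 102)] [cite: Miller2011LMS, Def. 1.1] -/
theorem missingLowerBoundAt_rankZero_of_evenReading
    (hGZK : rank_eq_analyticRank_of_analyticRank_le_one) (hmod : hasEntireLFunction_rat)
    (hR1 : EvenBranchPlusCharIdealOfPlusMCAt W p)
    (V : WeierstrassCurve ℚ) [V.IsElliptic] [V.IsGloballyMinimal] (C : VariableChange ℚ)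
    {N : ℕ} [NeZero N] {f : CuspForm (Gamma0 N) 2}
    (hp2 : p ≠ 2) (hCV : C • W.quadraticTwist ((-1) ^ (p / 2) * p) = V)
    (hgood : V.HasGoodReductionAtPrime p) (hap : V.frobeniusTrace p = 0)
    (h1 : QuadraticBranchPlusMainConjectureAt V p) (hf : IsNewformOf V f) {ϖ : ℚ}
    (hϖ : if Even (p / 2) then (ϖ : ℝ) * V.realPeriodRat = plusPeriod f
      else (ϖ : ℝ) * V.imaginaryPeriodRat = minusPeriod f)
    {L : IwasawaAlgebra p} (hL : IsQuadraticBranchPlusLFunction f p ϖ L)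
    (hLW : W.entireLFunction 1 ≠ 0) :
    MissingLowerBoundAt W p := by
  obtain ⟨q, hq⟩ := exists_rat_entireLFunction_one_div_of_twist W p hmod hp2 V C hCV hgood hf hϖ
  obtain ⟨hval, h0⟩ := valuation_constantCoeff_eq_padicValRat_of_twist p hmod hp2 W V C hCV hgood hf hϖ hL hq
  obtain ⟨-, hle⟩ := finite_and_valuation_le_padicValNat_card_add_of_reading W p hR1 V C hp2 hCV hgood hap
    h1 hf hϖ hL (h0 hLW)
  rw [hval] at hle
  exact missingLowerBoundAt_rankZero_of_selmer_le W p hGZK hLW hq hle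

/-- **`BSD(W, p)` in analytic rank `0` on the (12.5.2), Tamagawa-free, Manin-free Gss2 rows from
(R1⁺) + (C1_η) + Kato's Thm. 14.5(3)** — §3 without the Kitajima–Otsuki reading. CONDITIONAL on all
displayed inputs; nothing booked. [cite: Kato2004Asterisque, Thm. 14.5 (3) (p. 236), (12.5.2) (p. 222)]
[cite: Kobayashi2003, §4 (p. 8), Thm. 9.3 (p. 26), (3.6) (p. 7)] [cite: Miller2011LMS, §1 and Def. 1.1] -/
theorem bsdp_rankZero_of_evenReading_of_kato
    (hKato : Kato2004.rankZero_padicValNat_sha_le_of_additive_potGood_of_imageContainsSL2)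
    (hGZK : rank_eq_analyticRank_of_analyticRank_le_one) (hmod : hasEntireLFunction_rat)
    (hR1 : EvenBranchPlusCharIdealOfPlusMCAt W p)
    (V : WeierstrassCurve ℚ) [V.IsElliptic] [V.IsGloballyMinimal] (C : VariableChange ℚ)
    {N : ℕ} [NeZero N] {f : CuspForm (Gamma0 N) 2}
    (hp2 : p ≠ 2) (hCV : C • W.quadraticTwist ((-1) ^ (p / 2) * p) = V)
    (hgood : V.HasGoodReductionAtPrime p) (hap : V.frobeniusTrace p = 0)
    (h1 : QuadraticBranchPlusMainConjectureAt V p) (hf : IsNewformOf V f) {ϖ : ℚ}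
    (hϖ : if Even (p / 2) then (ϖ : ℝ) * V.realPeriodRat = plusPeriod f
      else (ϖ : ℝ) * V.imaginaryPeriodRat = minusPeriod f)
    {L : IwasawaAlgebra p} (hL : IsQuadraticBranchPlusLFunction f p ϖ L)
    (hr : W.analyticRank = 0) (hX : ClassX4 W p)
    (hsurj : ∀ n : ℕ, W.HasSurjectiveModNGaloisRep (p ^ n : ℕ)) (htam : ¬ p ∣ W.tamagawaProduct)
    {M : ℕ} [NeZero M] (D : ModularParametrizationData W M) (hc : ¬ (p : ℤ) ∣ D.maninConstant) :
    BSDp W p := by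
  have hLW : W.entireLFunction 1 ≠ 0 := by
    rw [← W.leadingLCoeff_eq_of_analyticRank_eq_zero hr]
    exact W.leadingLCoeff_ne_zero_holds (hmod W)
  have htw : (W.quadraticTwist ((-1 : ℚ) ^ (p / 2) * p)).HasGoodReductionAtPrime p := by
    rw [← hCV] at hgood
    exact (BSZLemma17.hasGoodReductionAtPrime_smul_iff _ C p).mp hgood
  have hpot : 0 ≤ padicValRat p W.j :=
    padicValRat_j_nonneg_of_typeG W p (typeG_of_hasGoodReductionAtPrime_quadraticTwist W p hp2 htw)
  exact X4RankZero.bsdp_of_missingLowerBoundAt_of_kato W p hKato hGZK hmod hr hX hpot hsurj htam D hc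
    (missingLowerBoundAt_rankZero_of_evenReading W p hGZK hmod hR1 V C hp2 hCV hgood hap h1 hf hϖ hL hLW)

/-- **`BSD(W, p)` in analytic rank `0` from (R1⁺) + (C1_η) + Kato's Tamagawa-exact upper half, NO
Tamagawa / Manin side condition**: on `ClassX4` rows (additive at the odd prime `p`, `E[p]` irreducible)
with tower surjectivity, §4's lower half and o6-r1's `X4RankZero.bsdp_of_missingLowerBoundAt_of_katoTam`
(Kato Thm. 14.5(3) + Prop. 14.16(2), binder `hKatoT`) give Miller's `BSD(W,p)`. CONDITIONAL on all
displayed inputs; nothing booked. [cite: Kato2004Asterisque, Thm. 14.5 (3) (p. 236), Prop. 14.16 (2) (p. 244)]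
[cite: Kobayashi2003, §4 (p. 8), Thm. 9.3 (p. 26), (3.6) (p. 7)] [cite: Miller2011LMS, §1 and Def. 1.1] -/
theorem bsdp_rankZero_of_evenReading_of_katoTam
    (hKatoT : Kato2004.rankZero_padicValNat_sha_add_padicValNat_tamagawa_le_of_additive_potGood_of_imageContainsSL2)
    (hGZK : rank_eq_analyticRank_of_analyticRank_le_one) (hmod : hasEntireLFunction_rat)
    (hR1 : EvenBranchPlusCharIdealOfPlusMCAt W p)
    (V : WeierstrassCurve ℚ) [V.IsElliptic] [V.IsGloballyMinimal] (C : VariableChange ℚ)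
    {N : ℕ} [NeZero N] {f : CuspForm (Gamma0 N) 2}
    (hp2 : p ≠ 2) (hCV : C • W.quadraticTwist ((-1) ^ (p / 2) * p) = V)
    (hgood : V.HasGoodReductionAtPrime p) (hap : V.frobeniusTrace p = 0)
    (h1 : QuadraticBranchPlusMainConjectureAt V p) (hf : IsNewformOf V f) {ϖ : ℚ}
    (hϖ : if Even (p / 2) then (ϖ : ℝ) * V.realPeriodRat = plusPeriod f
      else (ϖ : ℝ) * V.imaginaryPeriodRat = minusPeriod f)
    {L : IwasawaAlgebra p} (hL : IsQuadraticBranchPlusLFunction f p ϖ L)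
    (hr : W.analyticRank = 0) (hX : ClassX4 W p)
    (hsurj : ∀ n : ℕ, W.HasSurjectiveModNGaloisRep (p ^ n : ℕ)) : BSDp W p := by
  have hLW : W.entireLFunction 1 ≠ 0 := by
    rw [← W.leadingLCoeff_eq_of_analyticRank_eq_zero hr]
    exact W.leadingLCoeff_ne_zero_holds (hmod W)
  have htw : (W.quadraticTwist ((-1 : ℚ) ^ (p / 2) * p)).HasGoodReductionAtPrime p := by
    rw [← hCV] at hgood
    exact (BSZLemma17.hasGoodReductionAtPrime_smul_iff _ C p).mp hgood
  have hpot : 0 ≤ padicValRat p W.j :=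
    padicValRat_j_nonneg_of_typeG W p (typeG_of_hasGoodReductionAtPrime_quadraticTwist W p hp2 htw)
  exact X4RankZero.bsdp_of_missingLowerBoundAt_of_katoTam W p hKatoT hGZK hmod hr hX hpot hsurj
    (missingLowerBoundAt_rankZero_of_evenReading W p hGZK hmod hR1 V C hp2 hCV hgood hap h1 hf hϖ hL hLW)

end EvenControlZero

end Summit.BirchSwinnertonDyer.Rank1Residual.Additive

end
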